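import Summits.NavierStokesRegularity.NavierStokesRegularity.Theorems.AdaptedFrequencyAdaptedFrequencyConvergesStubEnstrophyC2Tools
import Literature.Analysis.FluidPDE.KNSSLiouvillePlanarHolds
import Literature.Analysis.FluidPDE.SmoothLocalEnergy

/-! # Second-order kernel calculus, jet bounds — crux stmt-NavierStokesRegularity-10493
(`AdaptedFrequency.AdaptedFrequencyConverges`), line unsteadiness-squeeze, stub `stub_enstrophyC2`

Helper file 2 (`--supports stmt-NavierStokesRegularity-10493`; theorems only; continues
`…StubEnstrophyC2Tools`) for the registered stub `stub_enstrophyC2`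
(`H = adaptedEnstrophy u G ∈ C²` near `T`). Slice-wise (fixed time) Leibniz
bounds for the right-hand sides of the two evolution equations that drive the time derivative of
the jet `J = (ω, ∇u, ∇ω)`, `ω = curl u`, in terms of one constant `L` bounding `Dᵏu` (`k ≤ 4`)
and `Dᵏω` (`k ≤ 3`):

* `enstrophyC2_norm_iteratedFDeriv_vorticityRHS_le` — for the vorticity equation
  `∂ₜω = (∇u)ω + νΔω − (∇ω)u`: `‖Dⁿ((∇u)ω + νΔω − (∇ω)u)‖ ≤ 4L² + 3|ν|L`, `n ≤ 1`;
* `enstrophyC2_norm_iteratedFDeriv_momentumRHS_le` — for the momentum equation with a pressure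
  `Q ∈ C²`, `‖D²Q‖ ≤ P`: `‖D(νΔu − ∇Q − (∇u)u)‖ ≤ 3|ν|L + P + 2L²`;
* `enstrophyC2_norm_iteratedFDeriv_comp_le` — `‖Dⁿ(Φ ∘ f)‖ ≤ 2 C (max 1 L)²` (`n ≤ 2`) for a
  smooth `Φ` whose derivatives of orders `≤ 2` are bounded by `C` on the ball of radius `L`
  containing `f`, `‖Dⁱf‖ ≤ L` (Faà di Bruno, Mathlib's `norm_iteratedFDeriv_comp_le`);
* `enstrophyC2_norm_iteratedFDeriv_jet_le` — derivatives of the triple `(ω, ∇u, ∇ω)` (sup norm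
  of a product).
-/

noncomputable section

open scoped Topology InnerProductSpace RealInnerProductSpace Laplacian ContDiff
open Literature.Analysis.FluidPDE Set Filter MeasureTheory Function Metric

namespace Summit.NavierStokesRegularity.NavierStokesRegularity.Theorems.AdaptedFrequencyConverges.UnsteadinessSqueeze

/-- The Laplacian of a smooth field is smooth (all finite orders, `contDiff_laplacian`). -/
theorem enstrophyC2_contDiff_laplacian {F : Type*} [NormedAddCommGroup F] [InnerProductSpace ℝ F]
    {f : EuclideanSpace ℝ (Fin 3) → F} (hf : ContDiff ℝ ∞ f) : ContDiff ℝ ∞ fun y => Δ f y :=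
  contDiff_infty.2 fun n => contDiff_laplacian (n := n) (by
    have h := hf.of_le (m := ((n + 2 : ℕ) : ℕ∞ω)) (ENat.natCast_le_of_coe_top_le_withTop le_rfl _)
    exact_mod_cast h)

/-- **The right-hand side of the vorticity equation and its gradient are bounded**: for a smooth
field `v` with `‖Dᵏv‖ ≤ L` (`k ≤ 4`) and `‖Dᵏ(curl v)‖ ≤ L` (`k ≤ 3`),
`‖Dⁿ((∇v)ω + νΔω − (∇ω)v)(x)‖ ≤ 2L² + 3|ν|L + 2L²` for `n ≤ 1`, `ω = curl v`. -/
theorem enstrophyC2_norm_iteratedFDeriv_vorticityRHS_le {ν L : ℝ}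
    {v : EuclideanSpace ℝ (Fin 3) → EuclideanSpace ℝ (Fin 3)} (hv : ContDiff ℝ ∞ v) (hL0 : 0 ≤ L)
    (huk : ∀ k ≤ 4, ∀ x, ‖iteratedFDeriv ℝ k v x‖ ≤ L)
    (hωk : ∀ k ≤ 3, ∀ x, ‖iteratedFDeriv ℝ k (curl v) x‖ ≤ L) {n : ℕ} (hn : n ≤ 1)
    (x : EuclideanSpace ℝ (Fin 3)) :
    ‖iteratedFDeriv ℝ n ((fun y => fderiv ℝ v y (curl v y)) + ν • (fun y => Δ (curl v) y) -
        fun y => fderiv ℝ (curl v) y (v y)) x‖ ≤ 2 * L ^ 2 + |ν| * (3 * L) + 2 * L ^ 2 := by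
  have hωs : ContDiff ℝ ∞ (curl v) := by
    rw [curl_eq_curlCLM_comp]; exact curlCLM.contDiff.comp (hv.fderiv_right (m := ∞) le_rfl)
  have hAs : ContDiff ℝ ∞ (fderiv ℝ v) := hv.fderiv_right (m := ∞) le_rfl
  have hBs : ContDiff ℝ ∞ (fderiv ℝ (curl v)) := hωs.fderiv_right (m := ∞) le_rfl
  have hAk : ∀ k ≤ 3, ‖iteratedFDeriv ℝ k (fderiv ℝ v) x‖ ≤ L := fun k hk => by
    rw [norm_iteratedFDeriv_fderiv]; exact huk (k + 1) (by omega) x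
  have hBk : ∀ k ≤ 2, ‖iteratedFDeriv ℝ k (fderiv ℝ (curl v)) x‖ ≤ L := fun k hk => by
    rw [norm_iteratedFDeriv_fderiv]; exact hωk (k + 1) (by omega) x
  have hcv : ContDiff ℝ ∞ fun y => fderiv ℝ v y (curl v y) := hAs.clm_apply hωs
  have hlc : ContDiff ℝ ∞ fun y => Δ (curl v) y := enstrophyC2_contDiff_laplacian hωs
  have htc : ContDiff ℝ ∞ fun y => fderiv ℝ (curl v) y (v y) := hBs.clm_apply hv
  have h1 : ‖iteratedFDeriv ℝ n (fun y => fderiv ℝ v y (curl v y)) x‖ ≤ 2 ^ n * L ^ 2 :=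
    enstrophyC2_norm_iteratedFDeriv_clm_apply_le hAs hωs hL0
      (fun i hi => hAk i (by omega)) (fun i hi => hωk i (by omega) x)
  have h2 : ‖iteratedFDeriv ℝ n (fun y => Δ (curl v) y) x‖ ≤ 3 * L := by
    refine (norm_iteratedFDeriv_laplacian_le hωs n x).trans ?_
    rw [finrank_euclideanSpace_fin, Nat.cast_ofNat]
    exact mul_le_mul_of_nonneg_left (hωk (n + 2) (by omega) x) (by norm_num)
  have h3 : ‖iteratedFDeriv ℝ n (fun y => fderiv ℝ (curl v) y (v y)) x‖ ≤ 2 ^ n * L ^ 2 :=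
    enstrophyC2_norm_iteratedFDeriv_clm_apply_le hBs hv hL0
      (fun i hi => hBk i (by omega)) (fun i hi => huk i (by omega) x)
  have h2n : (2 : ℝ) ^ n ≤ 2 := by
    interval_cases n <;> norm_num
  have hcast : (n : ℕ∞ω) ≤ ∞ := mod_cast le_top
  have hνlc : ContDiff ℝ ∞ (ν • fun y => Δ (curl v) y) := hlc.const_smul ν
  have hsum : ContDiff ℝ ∞ ((fun y => fderiv ℝ v y (curl v y)) + ν • fun y => Δ (curl v) y) :=
    hcv.add hνlc
  rw [iteratedFDeriv_sub_apply (hsum.contDiffAt.of_le hcast) (htc.contDiffAt.of_le hcast),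
    iteratedFDeriv_add_apply (hcv.contDiffAt.of_le hcast) (hνlc.contDiffAt.of_le hcast),
    iteratedFDeriv_const_smul_apply (hlc.contDiffAt.of_le hcast)]
  calc ‖iteratedFDeriv ℝ n (fun y => fderiv ℝ v y (curl v y)) x +
        ν • iteratedFDeriv ℝ n (fun y => Δ (curl v) y) x -
        iteratedFDeriv ℝ n (fun y => fderiv ℝ (curl v) y (v y)) x‖
      ≤ ‖iteratedFDeriv ℝ n (fun y => fderiv ℝ v y (curl v y)) x‖ +
        ‖ν • iteratedFDeriv ℝ n (fun y => Δ (curl v) y) x‖ +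
        ‖iteratedFDeriv ℝ n (fun y => fderiv ℝ (curl v) y (v y)) x‖ :=
        (norm_sub_le _ _).trans (add_le_add (norm_add_le _ _) le_rfl)
    _ ≤ 2 * L ^ 2 + |ν| * (3 * L) + 2 * L ^ 2 := by
        rw [norm_smul, Real.norm_eq_abs]
        have hL2 : 0 ≤ L ^ 2 := sq_nonneg L
        gcongr
        · nlinarith
        · nlinarith

/-- **The gradient of the right-hand side of the momentum equation is bounded**: for a smooth
field `v` with `‖Dᵏv‖ ≤ L` (`k ≤ 4`) and a pressure `Q ∈ C²` with `‖D²Q‖ ≤ P`,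
`‖D(νΔv − ∇Q − (∇v)v)(x)‖ ≤ 3|ν|L + P + 2L²` (`∇Q = toDual⁻¹ ∘ DQ` is an isometric image of
`DQ`). -/
theorem enstrophyC2_norm_iteratedFDeriv_momentumRHS_le {ν L P : ℝ}
    {v : EuclideanSpace ℝ (Fin 3) → EuclideanSpace ℝ (Fin 3)} (hv : ContDiff ℝ ∞ v) (hL0 : 0 ≤ L)
    (huk : ∀ k ≤ 4, ∀ x, ‖iteratedFDeriv ℝ k v x‖ ≤ L) {Q : EuclideanSpace ℝ (Fin 3) → ℝ}
    (hQ2 : ContDiff ℝ 2 Q) (hP : ∀ x, ‖iteratedFDeriv ℝ 2 Q x‖ ≤ P) (x : EuclideanSpace ℝ (Fin 3)) :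
    ‖iteratedFDeriv ℝ 1 (ν • (fun y => Δ v y) - gradient Q - fun y => fderiv ℝ v y (v y)) x‖ ≤
      |ν| * (3 * L) + P + 2 * L ^ 2 := by
  have hAs : ContDiff ℝ ∞ (fderiv ℝ v) := hv.fderiv_right (m := ∞) le_rfl
  have hAk : ∀ k ≤ 3, ‖iteratedFDeriv ℝ k (fderiv ℝ v) x‖ ≤ L := fun k hk => by
    rw [norm_iteratedFDeriv_fderiv]; exact huk (k + 1) (by omega) x
  have hlu : ContDiff ℝ ∞ fun y => Δ v y := enstrophyC2_contDiff_laplacian hv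
  have hgQ : ContDiff ℝ 1 (gradient Q) :=
    contDiff_gradient (n := 1) (by rw [show ((1 : ℕ∞ω) + 1) = 2 by norm_num]; exact hQ2)
  have hcu : ContDiff ℝ ∞ fun y => fderiv ℝ v y (v y) := hAs.clm_apply hv
  have h1 : ‖iteratedFDeriv ℝ 1 (fun y => Δ v y) x‖ ≤ 3 * L := by
    refine (norm_iteratedFDeriv_laplacian_le hv 1 x).trans ?_
    rw [finrank_euclideanSpace_fin, Nat.cast_ofNat]
    exact mul_le_mul_of_nonneg_left (huk 3 (by norm_num) x) (by norm_num)
  have h2 : ‖iteratedFDeriv ℝ 1 (gradient Q) x‖ ≤ P := by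
    have e : gradient Q =
        ⇑(InnerProductSpace.toDual ℝ (EuclideanSpace ℝ (Fin 3))).symm ∘ fderiv ℝ Q := rfl
    rw [e, LinearIsometryEquiv.norm_iteratedFDeriv_comp_left, norm_iteratedFDeriv_fderiv]
    exact hP x
  have h3 : ‖iteratedFDeriv ℝ 1 (fun y => fderiv ℝ v y (v y)) x‖ ≤ 2 ^ 1 * L ^ 2 :=
    enstrophyC2_norm_iteratedFDeriv_clm_apply_le hAs hv hL0
      (fun i hi => hAk i (by omega)) (fun i hi => huk i (by omega) x)
  have hcast : ((1 : ℕ) : ℕ∞ω) ≤ ∞ := mod_cast le_top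
  have hνlu : ContDiff ℝ ∞ (ν • fun y => Δ v y) := hlu.const_smul ν
  have hdiff : ContDiff ℝ 1 ((ν • fun y => Δ v y) - gradient Q) := (hνlu.of_le hcast).sub hgQ
  rw [iteratedFDeriv_sub_apply hdiff.contDiffAt (hcu.contDiffAt.of_le hcast),
    iteratedFDeriv_sub_apply (hνlu.contDiffAt.of_le hcast) hgQ.contDiffAt,
    iteratedFDeriv_const_smul_apply (hlu.contDiffAt.of_le hcast)]
  calc ‖ν • iteratedFDeriv ℝ 1 (fun y => Δ v y) x - iteratedFDeriv ℝ 1 (gradient Q) x -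
        iteratedFDeriv ℝ 1 (fun y => fderiv ℝ v y (v y)) x‖
      ≤ ‖ν • iteratedFDeriv ℝ 1 (fun y => Δ v y) x‖ + ‖iteratedFDeriv ℝ 1 (gradient Q) x‖ +
        ‖iteratedFDeriv ℝ 1 (fun y => fderiv ℝ v y (v y)) x‖ :=
        (norm_sub_le _ _).trans (add_le_add (norm_sub_le _ _) le_rfl)
    _ ≤ |ν| * (3 * L) + P + 2 * L ^ 2 := by
        rw [norm_smul, Real.norm_eq_abs]
        gcongr
        linarith

/-- **Derivatives of a smooth function of a bounded jet** (Faà di Bruno): if the derivatives of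
orders `≤ 2` of `Φ` are bounded by `C` on the ball of radius `L`, `‖f(x)‖ ≤ L` and `‖Dⁱf(x)‖ ≤ L`
for `i ≤ 2`, then `‖Dⁿ(Φ ∘ f)(x)‖ ≤ 2 C (max 1 L)²` for `n ≤ 2`. -/
theorem enstrophyC2_norm_iteratedFDeriv_comp_le {V : Type*} [NormedAddCommGroup V]
    [NormedSpace ℝ V] {Φ : V → ℝ} (hΦ : ContDiff ℝ ∞ Φ) {f : EuclideanSpace ℝ (Fin 3) → V}
    (hf : ContDiff ℝ ∞ f) {L C : ℝ} (hC0 : 0 ≤ C)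
    (hC : ∀ i ≤ 2, ∀ v : V, ‖v‖ ≤ L → ‖iteratedFDeriv ℝ i Φ v‖ ≤ C) {x : EuclideanSpace ℝ (Fin 3)}
    (hf0 : ‖f x‖ ≤ L) (hfi : ∀ i ≤ 2, ‖iteratedFDeriv ℝ i f x‖ ≤ L) {n : ℕ} (hn : n ≤ 2) :
    ‖iteratedFDeriv ℝ n (Φ ∘ f) x‖ ≤ 2 * C * max 1 L ^ 2 := by
  have hD1 : 1 ≤ max 1 L := le_max_left _ _
  have hD0 : 0 ≤ max 1 L := zero_le_one.trans hD1
  have h := norm_iteratedFDeriv_comp_le (g := Φ) (f := f) (n := n) (N := ∞) hΦ hf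
    (mod_cast le_top) x (C := C) (D := max 1 L)
    (fun i hi => hC i (hi.trans hn) _ hf0)
    (fun i hi1 hi2 => (hfi i (hi2.trans hn)).trans
      ((le_max_right _ _).trans (le_self_pow₀ hD1 (by omega))))
  refine h.trans ?_
  have hfac : ((n.factorial : ℕ) : ℝ) ≤ 2 := by
    interval_cases n <;> norm_num [Nat.factorial]
  have hpow : max 1 L ^ n ≤ max 1 L ^ 2 := pow_le_pow_right₀ hD1 hn
  exact mul_le_mul (mul_le_mul_of_nonneg_right hfac hC0) hpow (pow_nonneg hD0 n) (by positivity)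

/-- **Derivatives of the jet `(curl v, ∇v, ∇(curl v))`**: the `i`-th derivative of the triple has
the sup norm of the three `i`-th derivatives (`iteratedFDeriv_prodMk`, `opNorm_prod`). -/
theorem enstrophyC2_norm_iteratedFDeriv_jet_le
    {v : EuclideanSpace ℝ (Fin 3) → EuclideanSpace ℝ (Fin 3)} (hv : ContDiff ℝ ∞ v) {L : ℝ}
    {i : ℕ} {x : EuclideanSpace ℝ (Fin 3)} (hωi : ‖iteratedFDeriv ℝ i (curl v) x‖ ≤ L)
    (hAi : ‖iteratedFDeriv ℝ i (fderiv ℝ v) x‖ ≤ L)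
    (hBi : ‖iteratedFDeriv ℝ i (fderiv ℝ (curl v)) x‖ ≤ L) :
    ‖iteratedFDeriv ℝ i (fun y => (curl v y, (fderiv ℝ v y, fderiv ℝ (curl v) y))) x‖ ≤ L := by
  have hωs : ContDiff ℝ ∞ (curl v) := by
    rw [curl_eq_curlCLM_comp]; exact curlCLM.contDiff.comp (hv.fderiv_right (m := ∞) le_rfl)
  have hAs : ContDiff ℝ ∞ (fderiv ℝ v) := hv.fderiv_right (m := ∞) le_rfl
  have hBs : ContDiff ℝ ∞ (fderiv ℝ (curl v)) := hωs.fderiv_right (m := ∞) le_rfl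
  rw [iteratedFDeriv_prodMk (hωs.contDiffAt (n := ∞)) ((hAs.prodMk hBs).contDiffAt (n := ∞))
      (mod_cast le_top), ContinuousMultilinearMap.opNorm_prod,
    iteratedFDeriv_prodMk (hAs.contDiffAt (n := ∞)) (hBs.contDiffAt (n := ∞)) (mod_cast le_top),
    ContinuousMultilinearMap.opNorm_prod]
  exact max_le hωi (max_le hAi hBi)

end Summit.NavierStokesRegularity.NavierStokesRegularity.Theorems.AdaptedFrequencyConverges.UnsteadinessSqueeze

end
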